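import Summits.ResolutionOfSingularities.ResolutionOfSingularities.Theorems.FrobeniusLadderFInjectiveMacaulayficationClosedCentreRungs
import Summits.ResolutionOfSingularities.ResolutionOfSingularities.Theorems.FrobeniusLadderFInjectiveMacaulayficationTameWildSplitDimLe
import HarnessLib.Audit
import HarnessLib

/-!
# #4β in dimension ≤ 2 for GENERAL (separated, finite-type) surfaces: the TAME half is a theorem modulo Lipman; the WILD residual
# (crux `FInjectiveMacaulayfication` stmt-ResolutionOfSingularities-15315, chain w45a; plan-1 R16.28 (A2), de-affinization of the dim-≤-2 rung)

[OURS · L1 W4.5a · res-L1-w45a-lead-1] Support file (`--supports stmt-ResolutionOfSingularities-15315 --as helper`); NOT a statement of any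
manuscript; AI-written, weaker than expert review; no named fact introduced (Lipman 1978 = `Lipman1978SequenceFinite`, BY NAME).
The tree's dim-≤-2 rung of #4β is AFFINE (`TameWildSplit.closedCentreExistsAffineDimLe2_of_lipman`: the «affine» comes from W2, whose global
centre is the Lipman regular model of an AFFINE non-normal surface — the normalisation of an affine variety is a blowing up,
`RegularBlowupModelDim2.exists_isBlowup_normalizationι`).  For a GENERAL separated finite-type surface the TAME branch is already global: at a
NORMAL bad closed point `b` the `𝔪_b`-primary point-fix datum of T2 (`TameWildSplit.h4LocTameDimLe2_of_lipman`, per point, any `X₁`) globalises by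
`PointFixableCentre.pointFixable_h4` (centre supported at `{b}`, extended by `⊤`).  What remains is the WILD residual `ClosedCentreExistsDimLe2Wild`
(non-normal `b`): it needs ONE blowing up of the non-affine surface `X₁` supported on its (closed) non-regular locus with regular source — i.e. the
normalisation of a non-affine surface as a blowing up (Liu 2002 Thm. 8.1.24 is printed for quasi-projective bases; the tree has the projective
case `Liu2002Thm8124Projective_holds` and the affine case) followed by `RegularBlowupModelSupported.exists_regular_isBlowup_supported_of_lipman`.

* `ClosedCentreExistsDimLe2Wild` — `ClosedCentreRungs.ClosedCentreExistsDimLe2` with `¬ IsIntegrallyClosed (X₁.presheaf.stalk b) →` inserted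
  before the conclusion [OURS · candidate; the honest residual of the de-affinization];
* `closedCentreExistsDimLe2_of_lipman_of_wild (hL) (hW : ClosedCentreExistsDimLe2Wild) : ClosedCentreExistsDimLe2` — PROVED (tame branch by T2);
* `closedCentreExistsDimLe2Wild_of_dimLe2` — the residual is a weakening (sanity).
-/

-- single-problem summit: the doubled namespace component is forced
set_option linter.dupNamespace false
set_option autoImplicit false

noncomputable section

open CategoryTheory AlgebraicGeometry
open Literature.AlgebraicGeometry.Resolution

namespace Summit.ResolutionOfSingularities.ResolutionOfSingularities.Theorems.FInjectiveMacaulayfication.ClosedCentreDimLe2Tame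

open Summit.ResolutionOfSingularities.ResolutionOfSingularities.Theorems.FInjectiveMacaulayfication

/-- [OURS · candidate statement, the WILD RESIDUAL of #4β in dimension ≤ 2] **#4β at a NON-NORMAL bad closed point of a general surface** —
`ClosedCentreRungs.ClosedCentreExistsDimLe2` VERBATIM with `¬ IsIntegrallyClosed (X₁.presheaf.stalk b) →` inserted before the conclusion.
Known for AFFINE `X₁` (`TameWildSplit.wfixClosedAffineDimLe2_of_lipman`); the general case needs the normalisation of a non-affine surface as
ONE blowing up supported on the non-normal locus (see the module docstring). [candidate statement, OURS] -/
@[conjecture] def ClosedCentreExistsDimLe2Wild : Prop :=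
    ∀ (p : ℕ), p.Prime → ∀ (k : Type) [Field k] [CharP k p] (X₁ : Scheme.{0}) (f₁ : X₁ ⟶ Spec (.of k)),
    IsSeparated f₁ → LocallyOfFiniteType f₁ → QuasiCompact f₁ → IsIntegral X₁ → topologicalKrullDim X₁ ≤ 2 →
    (∀ x : X₁, ∀ d : ℕ, ringKrullDim (X₁.presheaf.stalk x) = d → ∀ s : Fin d → X₁.presheaf.stalk x, (Ideal.span (Set.range s)).radical.IsMaximal → RingTheory.Sequence.IsWeaklyRegular (X₁.presheaf.stalk x) (List.ofFn s)) →
    Set.Finite {x : X₁ | ¬ ∀ d : ℕ, ringKrullDim (X₁.presheaf.stalk x) = d → ∀ s : Fin d → X₁.presheaf.stalk x, (Ideal.span (Set.range s)).radical.IsMaximal → ∀ y : X₁.presheaf.stalk x, (∃ e : ℕ, y ^ p ^ e ∈ Ideal.span ((fun z : X₁.presheaf.stalk x => z ^ p ^ e) '' (Ideal.span (Set.range s) : Set (X₁.presheaf.stalk x)))) → y ∈ Ideal.span (Set.range s)} →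
    ∀ b : X₁, IsClosed ({b} : Set X₁) → (¬ ∀ d : ℕ, ringKrullDim (X₁.presheaf.stalk b) = d → ∀ s : Fin d → X₁.presheaf.stalk b, (Ideal.span (Set.range s)).radical.IsMaximal → ∀ y : X₁.presheaf.stalk b, (∃ e : ℕ, y ^ p ^ e ∈ Ideal.span ((fun z : X₁.presheaf.stalk b => z ^ p ^ e) '' (Ideal.span (Set.range s) : Set (X₁.presheaf.stalk b)))) → y ∈ Ideal.span (Set.range s)) →
      ¬ IsIntegrallyClosed (X₁.presheaf.stalk b) →
      ∃ J : X₁.IdealSheafData, J ≠ ⊥ ∧ b ∈ (J.support : Set X₁) ∧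
        ∀ (X' : Scheme.{0}) (π : X' ⟶ X₁), Literature.AlgebraicGeometry.Resolution.IsBlowup π J →
          ∀ x' : X', π.base x' ∈ (J.support : Set X₁) → IsDomain (X'.presheaf.stalk x') ∧ ∀ d : ℕ, ringKrullDim (X'.presheaf.stalk x') = d → ∀ s : Fin d → X'.presheaf.stalk x', (Ideal.span (Set.range s)).radical.IsMaximal → RingTheory.Sequence.IsWeaklyRegular (X'.presheaf.stalk x') (List.ofFn s) ∧ ∀ y : X'.presheaf.stalk x', (∃ e : ℕ, y ^ p ^ e ∈ Ideal.span ((fun z : X'.presheaf.stalk x' => z ^ p ^ e) '' (Ideal.span (Set.range s) : Set (X'.presheaf.stalk x')))) → y ∈ Ideal.span (Set.range s)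


/-- Sanity: the wild residual is a weakening of the dim-≤-2 rung. [plumbing] -/
theorem closedCentreExistsDimLe2Wild_of_dimLe2 (h : ClosedCentreRungs.ClosedCentreExistsDimLe2) : ClosedCentreExistsDimLe2Wild :=
  fun p hp k _ _ X₁ f₁ hs hl hq hi hdim hc hf b hbcl hb _ => h p hp k X₁ f₁ hs hl hq hi hdim hc hf b hbcl hb

/-- **#4β in dimension ≤ 2 for EVERY separated finite-type integral surface, modulo Lipman 1978 and the WILD residual**: case on normality
of `𝒪_{X₁,b}`; at a normal (tame) bad closed point the point-fix datum of T2 (`TameWildSplit.h4LocTameDimLe2_of_lipman hL`, using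
`dim 𝒪_{X₁,b} ≤ dim X₁ ≤ 2` via `TameWildSplit.ringKrullDim_stalk_le`) globalises by `PointFixableCentre.pointFixable_h4`; at a non-normal
point the residual `ClosedCentreExistsDimLe2Wild` is the datum.  No affineness anywhere. [OURS assembly; cite: Liu2002, Thm. 8.3.44] -/
theorem closedCentreExistsDimLe2_of_lipman_of_wild (hL : Lipman1978SequenceFinite.{0}) (hW : ClosedCentreExistsDimLe2Wild) :
    ClosedCentreRungs.ClosedCentreExistsDimLe2 := by
  intro p hp k _ _ X₁ f₁ hs hl hq hi hdim hc hf b hbcl hb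
  by_cases hn : IsIntegrallyClosed (X₁.presheaf.stalk b)
  · exact PointFixableCentre.pointFixable_h4 p hp k X₁ f₁ hs hl hq hi hc hf b hbcl hb
      (TameWildSplit.h4LocTameDimLe2_of_lipman hL p hp k X₁ f₁ hs hl hq hi hc hf b hbcl hb hn
        (TameWildSplit.ringKrullDim_stalk_le hdim b))
  · exact hW p hp k X₁ f₁ hs hl hq hi hdim hc hf b hbcl hb hn

end Summit.ResolutionOfSingularities.ResolutionOfSingularities.Theorems.FInjectiveMacaulayfication.ClosedCentreDimLe2Tame

end
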